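import Mathlib
import Summits.NavierStokesRegularity.NavierStokesRegularity.Theorems.FilamentSkeletonRssKelvinGateSharpDefs

/-!
# Route `FilamentSkeletonRss` · crux `TransverseReduction1A` (stmt-27414; successor of the aside `TransverseReductionRJ`,
# stmt-21221) — line `kelvin_gate`: the PICARD ITERATION in the SHARP Y-scale (nonlinear closing against an abstract gate)

Helper file (theorems only, `--as helper`).  HONEST FRAMING: analysis bookkeeping for a HYPOTHETICAL filament-type rotating
self-similar blow-up route; nothing here bears on Navier–Stokes regularity; no stub is proved here.

Port of `…KelvinGateClosingPicard` (stub S3, coarse scales `XBound`/`YBound`) to the sharp scales `XSharp a`/`YSharp a` of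
`…KelvinGateSharpDefs` (`1 ≤ a`), in which the FREE gate actually exists (`free_kelvin_gate_ySharp`).  For ANY operator `K` on fields
of `ℝ³` with the operator bound `YSharp a F R → XSharp a (K F) (A·R)` and linearity on sharp-Y-bounded data, and ANY residual `r`
with `YSharp a r ε`, `16 A² ε ≤ 1`:

* `sharp_picard_maps_ball`, `sharp_picard_contracts` — the map `Φ F := −r − D(KF)[KF]` preserves the ball `Y♯ ≤ 2ε` and halves
  distances there (`Y♯(DW[W′]) ≤ 2 X♯(W) X♯(W′)`, `XSharp.ySharp_fderiv_apply`);
* `sharp_picard_exists_fixedPoint` — there is `F` with `YSharp a F (2ε)` and `F = −r − D(KF)[KF]` pointwise (Picard iterates from `0`,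
  geometric Cauchy estimates for the fields and their derivatives, `hasFDerivAt_of_tendstoUniformly`, weighted bounds pass to the limit).
The instantiation `K :=` the free sharp gate (small forced rotating-Leray profiles at the trivial base) is the next file.
-/

set_option linter.dupNamespace false

noncomputable section

namespace Summit.NavierStokesRegularity.NavierStokesRegularity.Theorems.KelvinGate

open Set Function Filter
open Literature.Analysis.FluidPDE
open scoped InnerProductSpace Laplacian ContDiff Topology

/-! ## The Picard map for an abstract gate `K` in the sharp scales -/

section SharpPicard

variable {a : ℝ} {K : (EuclideanSpace ℝ (Fin 3) → EuclideanSpace ℝ (Fin 3)) →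
    EuclideanSpace ℝ (Fin 3) → EuclideanSpace ℝ (Fin 3)} {A ε : ℝ}
  {r : EuclideanSpace ℝ (Fin 3) → EuclideanSpace ℝ (Fin 3)}

/-- **Linearity in difference form.**  If `K` is linear on Y-bounded data, then for Y-bounded `F, G`:
`K F y = K G y + K (F − G) y`. -/
theorem sharp_picard_K_sub
    (hK2 : ∀ (F G : EuclideanSpace ℝ (Fin 3) → EuclideanSpace ℝ (Fin 3)) (s : ℝ), (∃ R, YSharp a F R) →
      (∃ R, YSharp a G R) → K (fun y => F y + s • G y) = fun y => K F y + s • K G y)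
    {F G : EuclideanSpace ℝ (Fin 3) → EuclideanSpace ℝ (Fin 3)} {R S : ℝ} (hF : YSharp a F R) (hG : YSharp a G S) :
    ∀ y, K F y = K G y + K (fun z => F z - G z) y := by
  have hFG : YSharp a (fun z => F z - G z) (R + S) := hF.sub hG
  have e : (fun y => G y + (1:ℝ) • (fun z => F z - G z) y) = F := by
    funext y; simp
  have h := hK2 G (fun z => F z - G z) 1 ⟨S, hG⟩ ⟨R + S, hFG⟩
  rw [e] at h
  intro y
  have := congrFun h y
  simpa using this

/-- **The Picard map preserves the ball `Y ≤ 2ε`.**  With the operator bound `Y(F) ≤ R ⇒ X(K F) ≤ A R` and a residual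
`r` with `Y(r) ≤ ε`: if `16 A² ε ≤ 1` then `Y(F) ≤ 2ε ⇒ Y(−r − D(KF)[KF]) ≤ 2ε`
(indeed `≤ ε + 2 (2Aε)² = ε + 8A²ε·ε ≤ ε + ε/2`). -/
theorem sharp_picard_maps_ball (ha : 1 ≤ a)
    (hK1 : ∀ (F : EuclideanSpace ℝ (Fin 3) → EuclideanSpace ℝ (Fin 3)) (R : ℝ), YSharp a F R → XSharp a (K F) (A * R))
    (hr : YSharp a r ε) (hA : 16 * A ^ 2 * ε ≤ 1)
    {F : EuclideanSpace ℝ (Fin 3) → EuclideanSpace ℝ (Fin 3)} (hF : YSharp a F (2 * ε)) :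
    YSharp a (fun y => -r y - fderiv ℝ (K F) y (K F y)) (2 * ε) := by
  have hε : 0 ≤ ε := hr.nonneg
  have hW : XSharp a (K F) (A * (2 * ε)) := hK1 F _ hF
  have hB : YSharp a (fun y => fderiv ℝ (K F) y (K F y)) (2 * (A * (2 * ε)) * (A * (2 * ε))) :=
    hW.ySharp_fderiv_apply ha hW
  have h := hr.neg.sub hB
  refine h.mono ?_
  nlinarith [hA, hε, sq_nonneg A]

/-- **Pointwise form of the difference of two Picard images.**  For Y-bounded `F, G` with `H := K (F − G)`:
`Φ F y − Φ G y = −(D(KG)(y)[H y] + DH(y)[KF y])`. -/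
theorem sharp_picard_sub_eq
    (hK1 : ∀ (F : EuclideanSpace ℝ (Fin 3) → EuclideanSpace ℝ (Fin 3)) (R : ℝ), YSharp a F R → XSharp a (K F) (A * R))
    (hK2 : ∀ (F G : EuclideanSpace ℝ (Fin 3) → EuclideanSpace ℝ (Fin 3)) (s : ℝ), (∃ R, YSharp a F R) →
      (∃ R, YSharp a G R) → K (fun y => F y + s • G y) = fun y => K F y + s • K G y)
    {F G : EuclideanSpace ℝ (Fin 3) → EuclideanSpace ℝ (Fin 3)} {R S : ℝ} (hF : YSharp a F R) (hG : YSharp a G S)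
    (y : EuclideanSpace ℝ (Fin 3)) :
    (-r y - fderiv ℝ (K F) y (K F y)) - (-r y - fderiv ℝ (K G) y (K G y)) =
      -(fderiv ℝ (K G) y (K (fun z => F z - G z) y) + fderiv ℝ (K (fun z => F z - G z)) y (K F y)) := by
  have hsub := sharp_picard_K_sub hK2 hF hG
  have hKG : XSharp a (K G) (A * S) := hK1 G _ hG
  have hH : XSharp a (K (fun z => F z - G z)) (A * (R + S)) := hK1 _ _ (hF.sub hG)
  have eKF : K F = fun z => K G z + K (fun z => F z - G z) z := funext hsub
  have hdG : DifferentiableAt ℝ (K G) y := hKG.1.differentiable (by norm_num) y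
  have hdH : DifferentiableAt ℝ (K (fun z => F z - G z)) y := hH.1.differentiable (by norm_num) y
  have eD : fderiv ℝ (K F) y = fderiv ℝ (K G) y + fderiv ℝ (K (fun z => F z - G z)) y := by
    rw [eKF]; exact fderiv_fun_add hdG hdH
  rw [eD, _root_.add_apply, hsub y, map_add]
  abel

/-- **The Picard map halves Y-distances on the ball `Y ≤ 2ε`** (when `16 A² ε ≤ 1`):
`Y(F), Y(G) ≤ 2ε`, `Y(F − G) ≤ d` ⇒ `Y(Φ F − Φ G) ≤ d/2` (indeed `≤ 2(2Aε)(Ad) + 2(Ad)(2Aε) = 8A²ε·d`). -/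
theorem sharp_picard_contracts (ha : 1 ≤ a)
    (hK1 : ∀ (F : EuclideanSpace ℝ (Fin 3) → EuclideanSpace ℝ (Fin 3)) (R : ℝ), YSharp a F R → XSharp a (K F) (A * R))
    (hK2 : ∀ (F G : EuclideanSpace ℝ (Fin 3) → EuclideanSpace ℝ (Fin 3)) (s : ℝ), (∃ R, YSharp a F R) →
      (∃ R, YSharp a G R) → K (fun y => F y + s • G y) = fun y => K F y + s • K G y)
    (hr : YSharp a r ε) (hA : 16 * A ^ 2 * ε ≤ 1)
    {F G : EuclideanSpace ℝ (Fin 3) → EuclideanSpace ℝ (Fin 3)} (hF : YSharp a F (2 * ε)) (hG : YSharp a G (2 * ε))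
    {d : ℝ} (hFG : YSharp a (fun y => F y - G y) d) :
    YSharp a (fun y => (-r y - fderiv ℝ (K F) y (K F y)) - (-r y - fderiv ℝ (K G) y (K G y))) (d / 2) := by
  have hε : 0 ≤ ε := hr.nonneg
  have hd : 0 ≤ d := hFG.nonneg
  have hKF : XSharp a (K F) (A * (2 * ε)) := hK1 F _ hF
  have hKG : XSharp a (K G) (A * (2 * ε)) := hK1 G _ hG
  have hH : XSharp a (K (fun z => F z - G z)) (A * d) := hK1 _ _ hFG
  have h1 : YSharp a (fun y => fderiv ℝ (K G) y (K (fun z => F z - G z) y)) (2 * (A * (2 * ε)) * (A * d)) :=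
    hKG.ySharp_fderiv_apply ha hH
  have h2 : YSharp a (fun y => fderiv ℝ (K (fun z => F z - G z)) y (K F y)) (2 * (A * d) * (A * (2 * ε))) :=
    hH.ySharp_fderiv_apply ha hKF
  have h := (h1.add h2).neg
  have e : (fun y => (-r y - fderiv ℝ (K F) y (K F y)) - (-r y - fderiv ℝ (K G) y (K G y))) =
      fun y => -(fderiv ℝ (K G) y (K (fun z => F z - G z) y) + fderiv ℝ (K (fun z => F z - G z)) y (K F y)) :=
    funext (sharp_picard_sub_eq hK1 hK2 hF hG)
  rw [e]
  refine h.mono ?_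
  have hA0 : 0 ≤ A ^ 2 * ε := by positivity
  nlinarith [hA, hε, hd, sq_nonneg A, mul_nonneg hA0 hd]

/-- **The Picard iterates** `F₀ = 0`, `F_{n+1} = Φ F_n` stay in the ball `Y ≤ 2ε` and have geometrically decreasing
increments `Y(F_{n+1} − F_n) ≤ 2ε / 2^n`.  (Stated for any sequence satisfying the recursion.) -/
theorem sharp_picard_seq_bounds (ha : 1 ≤ a)
    (hK1 : ∀ (F : EuclideanSpace ℝ (Fin 3) → EuclideanSpace ℝ (Fin 3)) (R : ℝ), YSharp a F R → XSharp a (K F) (A * R))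
    (hK2 : ∀ (F G : EuclideanSpace ℝ (Fin 3) → EuclideanSpace ℝ (Fin 3)) (s : ℝ), (∃ R, YSharp a F R) →
      (∃ R, YSharp a G R) → K (fun y => F y + s • G y) = fun y => K F y + s • K G y)
    (hr : YSharp a r ε) (hA : 16 * A ^ 2 * ε ≤ 1)
    {Fs : ℕ → EuclideanSpace ℝ (Fin 3) → EuclideanSpace ℝ (Fin 3)} (h0 : Fs 0 = fun _ => 0)
    (hsucc : ∀ n, Fs (n + 1) = fun y => -r y - fderiv ℝ (K (Fs n)) y (K (Fs n) y)) (n : ℕ) :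
    YSharp a (Fs n) (2 * ε) ∧ YSharp a (fun y => Fs (n + 1) y - Fs n y) (2 * ε / 2 ^ n) := by
  have hε : 0 ≤ ε := hr.nonneg
  induction n with
  | zero =>
    have hz : YSharp a (fun _ : EuclideanSpace ℝ (Fin 3) => (0 : EuclideanSpace ℝ (Fin 3))) (2 * ε) :=
      ySharp_zero.mono (by linarith)
    rw [h0]
    refine ⟨hz, ?_⟩
    have h1 := sharp_picard_maps_ball ha hK1 hr hA hz
    rw [hsucc 0, h0]
    simpa using h1
  | succ n ih =>
    obtain ⟨hn, hdn⟩ := ih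
    have hn1 : YSharp a (Fs (n + 1)) (2 * ε) := by
      rw [hsucc n]
      exact sharp_picard_maps_ball ha hK1 hr hA hn
    refine ⟨hn1, ?_⟩
    have h := sharp_picard_contracts ha hK1 hK2 hr hA hn1 hn hdn
    have e : (fun y => Fs (n + 1 + 1) y - Fs (n + 1) y) =
        fun y => (-r y - fderiv ℝ (K (Fs (n + 1))) y (K (Fs (n + 1)) y)) -
          (-r y - fderiv ℝ (K (Fs n)) y (K (Fs n) y)) := by
      funext y
      have e1 := congrFun (hsucc (n + 1)) y
      have e2 := congrFun (hsucc n) y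
      rw [e1, e2]
    rw [e]
    refine h.mono (le_of_eq ?_)
    rw [pow_succ]
    ring

/-- **Existence of the fixed-point forcing (Picard).**  Under the operator bound `Y(F) ≤ R ⇒ X(K F) ≤ A R`, linearity of
`K` on Y-bounded data, a residual with `Y(r) ≤ ε` and the smallness `16 A² ε ≤ 1`, there is a forcing `F` with
`Y(F) ≤ 2ε` and `F(y) = −r(y) − D(K F)(y)[K F(y)]` for every `y`. -/
theorem sharp_picard_exists_fixedPoint (ha : 1 ≤ a)
    (hK1 : ∀ (F : EuclideanSpace ℝ (Fin 3) → EuclideanSpace ℝ (Fin 3)) (R : ℝ), YSharp a F R → XSharp a (K F) (A * R))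
    (hK2 : ∀ (F G : EuclideanSpace ℝ (Fin 3) → EuclideanSpace ℝ (Fin 3)) (s : ℝ), (∃ R, YSharp a F R) →
      (∃ R, YSharp a G R) → K (fun y => F y + s • G y) = fun y => K F y + s • K G y)
    (hr : YSharp a r ε) (hA : 16 * A ^ 2 * ε ≤ 1) :
    ∃ F : EuclideanSpace ℝ (Fin 3) → EuclideanSpace ℝ (Fin 3),
      YSharp a F (2 * ε) ∧ ∀ y, F y = -r y - fderiv ℝ (K F) y (K F y) := by
  have hε : 0 ≤ ε := hr.nonneg
  -- the Picard sequence
  obtain ⟨Fs, h0, hsucc⟩ : ∃ Fs : ℕ → EuclideanSpace ℝ (Fin 3) → EuclideanSpace ℝ (Fin 3), (Fs 0 = fun _ => 0) ∧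
      ∀ n, Fs (n + 1) = fun y => -r y - fderiv ℝ (K (Fs n)) y (K (Fs n) y) :=
    ⟨fun n => (fun F => fun y => -r y - fderiv ℝ (K F) y (K F y))^[n] (fun _ => 0), rfl,
      fun n => Function.iterate_succ_apply' _ n _⟩
  have hb := fun n => sharp_picard_seq_bounds ha hK1 hK2 hr hA h0 hsucc n
  have hC1s : ∀ n, ContDiff ℝ 1 (Fs n) := fun n => (hb n).1.1
  have hdiff : ∀ n y, DifferentiableAt ℝ (Fs n) y := fun n y => (hC1s n).differentiable (by norm_num) y
  have h2n : ∀ n : ℕ, (2:ℝ) * ε / 2 ^ n = 2 * ε * (1 / 2) ^ n := fun n => by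
    rw [one_div, inv_pow, div_eq_mul_inv]
  -- weighted geometric increments, for the fields and for their derivatives
  have hdist : ∀ y n, dist (Fs n y) (Fs (n + 1) y) ≤ 2 * ε / (1 + ‖y‖) ^ (a + 1) * (1 / 2) ^ n := by
    intro y n
    rw [dist_comm, dist_eq_norm]
    have h := (hb n).2.norm_le y
    rw [h2n] at h
    calc ‖Fs (n + 1) y - Fs n y‖ ≤ 2 * ε * (1 / 2) ^ n / (1 + ‖y‖) ^ (a + 1) := h
      _ = 2 * ε / (1 + ‖y‖) ^ (a + 1) * (1 / 2) ^ n := by ring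
  have hdistD : ∀ y n, dist (fderiv ℝ (Fs n) y) (fderiv ℝ (Fs (n + 1)) y) ≤
      2 * ε / (1 + ‖y‖) ^ (a + 1) * (1 / 2) ^ n := by
    intro y n
    rw [dist_comm, dist_eq_norm]
    have h := ((hb n).2.2 y).2
    rw [fderiv_fun_sub (hdiff (n + 1) y) (hdiff n y), h2n] at h
    have e : 2 * ε / (1 + ‖y‖) ^ (a + 1) * (1 / 2 : ℝ) ^ n = 2 * ε * (1 / 2) ^ n / (1 + ‖y‖) ^ (a + 1) := by ring
    rw [e, le_div_iff₀ (by positivity)]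
    calc ‖fderiv ℝ (Fs (n + 1)) y - fderiv ℝ (Fs n) y‖ * (1 + ‖y‖) ^ (a + 1)
        = (1 + ‖y‖) ^ (a + 1) * ‖fderiv ℝ (Fs (n + 1)) y - fderiv ℝ (Fs n) y‖ := by ring
      _ ≤ 2 * ε * (1 / 2) ^ n := h
  -- pointwise limits (values in `ℝ³`, derivatives in `ℝ³ →L ℝ³`; both complete)
  have hlimF : ∀ y, ∃ v, Tendsto (fun n => Fs n y) atTop (𝓝 v) := fun y =>
    cauchySeq_tendsto_of_complete (cauchySeq_of_le_geometric (1 / 2) _ (by norm_num) (hdist y))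
  have hlimD : ∀ y, ∃ L, Tendsto (fun n => fderiv ℝ (Fs n) y) atTop (𝓝 L) := fun y =>
    cauchySeq_tendsto_of_complete (cauchySeq_of_le_geometric (1 / 2) _ (by norm_num) (hdistD y))
  choose Flim hFlim using hlimF
  choose Glim hGlim using hlimD
  -- geometric tails
  have htail : ∀ y n, dist (Fs n y) (Flim y) ≤ 4 * ε / (1 + ‖y‖) ^ (a + 1) * (1 / 2) ^ n := by
    intro y n
    have h := dist_le_of_le_geometric_of_tendsto (1 / 2) _ (by norm_num) (hdist y) (hFlim y) n
    calc dist (Fs n y) (Flim y) ≤ 2 * ε / (1 + ‖y‖) ^ (a + 1) * (1 / 2) ^ n / (1 - 1 / 2) := h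
      _ = 4 * ε / (1 + ‖y‖) ^ (a + 1) * (1 / 2) ^ n := by ring
  have htailD : ∀ y n, dist (fderiv ℝ (Fs n) y) (Glim y) ≤ 4 * ε / (1 + ‖y‖) ^ (a + 1) * (1 / 2) ^ n := by
    intro y n
    have h := dist_le_of_le_geometric_of_tendsto (1 / 2) _ (by norm_num) (hdistD y) (hGlim y) n
    calc dist (fderiv ℝ (Fs n) y) (Glim y) ≤ 2 * ε / (1 + ‖y‖) ^ (a + 1) * (1 / 2) ^ n / (1 - 1 / 2) := h
      _ = 4 * ε / (1 + ‖y‖) ^ (a + 1) * (1 / 2) ^ n := by ring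
  -- the derivatives converge uniformly (the weight is `≥ 1`)
  have hpow0 : Tendsto (fun n : ℕ => 4 * ε * (1 / 2 : ℝ) ^ n) atTop (𝓝 0) := by
    have h := (tendsto_pow_atTop_nhds_zero_of_lt_one (by norm_num : (0:ℝ) ≤ 1 / 2)
      (by norm_num : (1 / 2 : ℝ) < 1)).const_mul (4 * ε)
    rwa [mul_zero] at h
  have hunif : TendstoUniformly (fun n y => fderiv ℝ (Fs n) y) Glim atTop := by
    rw [Metric.tendstoUniformly_iff]
    intro δ hδ
    filter_upwards [(hpow0.eventually (gt_mem_nhds hδ))] with n hn y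
    rw [dist_comm]
    have hw : (1:ℝ) ≤ (1 + ‖y‖) ^ (a + 1) := Real.one_le_rpow (by linarith [norm_nonneg y]) (by linarith)
    calc dist (fderiv ℝ (Fs n) y) (Glim y) ≤ 4 * ε / (1 + ‖y‖) ^ (a + 1) * (1 / 2) ^ n := htailD y n
      _ ≤ 4 * ε / 1 * (1 / 2) ^ n := by
          gcongr
      _ = 4 * ε * (1 / 2) ^ n := by ring
      _ < δ := hn
  -- the limit is `C¹` with derivative `Glim`
  have hderiv : ∀ y, HasFDerivAt Flim (Glim y) y :=
    hasFDerivAt_of_tendstoUniformly hunif (fun n y => (hdiff n y).hasFDerivAt) hFlim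
  have hfd : fderiv ℝ Flim = Glim := funext fun y => (hderiv y).fderiv
  have hC1 : ContDiff ℝ 1 Flim := by
    rw [contDiff_one_iff_fderiv]
    refine ⟨fun y => (hderiv y).differentiableAt, ?_⟩
    rw [hfd]
    exact hunif.continuous (Eventually.of_forall fun n => (hC1s n).continuous_fderiv one_ne_zero).frequently
  -- weighted bounds pass to the limit: `Y(Flim) ≤ 2ε` and `Y(Fs n − Flim) ≤ 4ε (1/2)^n`
  have hYlim : YSharp a Flim (2 * ε) := by
    refine ⟨hC1, fun y => ⟨?_, ?_⟩⟩
    · refine le_of_tendsto ((hFlim y).norm.const_mul ((1 + ‖y‖) ^ (a + 1))) (Eventually.of_forall fun n => ?_)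
      exact ((hb n).1.2 y).1
    · rw [hfd]
      refine le_of_tendsto ((hGlim y).norm.const_mul ((1 + ‖y‖) ^ (a + 1))) (Eventually.of_forall fun n => ?_)
      exact ((hb n).1.2 y).2
  have hYdiff : ∀ n, YSharp a (fun y => Fs n y - Flim y) (4 * ε * (1 / 2) ^ n) := by
    intro n
    refine ⟨(hC1s n).sub hC1, fun y => ⟨?_, ?_⟩⟩
    · calc (1 + ‖y‖) ^ (a + 1) * ‖Fs n y - Flim y‖ = dist (Fs n y) (Flim y) * (1 + ‖y‖) ^ (a + 1) := by
            rw [dist_eq_norm]; ring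
        _ ≤ 4 * ε / (1 + ‖y‖) ^ (a + 1) * (1 / 2) ^ n * (1 + ‖y‖) ^ (a + 1) :=
            mul_le_mul_of_nonneg_right (htail y n) (by positivity)
        _ = 4 * ε * (1 / 2) ^ n := by field_simp
    · rw [fderiv_fun_sub (hdiff n y) ((hderiv y).differentiableAt), hfd]
      calc (1 + ‖y‖) ^ (a + 1) * ‖fderiv ℝ (Fs n) y - Glim y‖ = dist (fderiv ℝ (Fs n) y) (Glim y) * (1 + ‖y‖) ^ (a + 1) := by
            rw [dist_eq_norm]; ring
        _ ≤ 4 * ε / (1 + ‖y‖) ^ (a + 1) * (1 / 2) ^ n * (1 + ‖y‖) ^ (a + 1) :=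
            mul_le_mul_of_nonneg_right (htailD y n) (by positivity)
        _ = 4 * ε * (1 / 2) ^ n := by field_simp
  -- the fixed-point identity: pass to the limit in `F_{n+1} = Φ F_n`
  refine ⟨Flim, hYlim, fun y => ?_⟩
  have hKlim : XSharp a (K Flim) (A * (2 * ε)) := hK1 _ _ hYlim
  have hA0 : 0 ≤ A := by
    have h := (hK1 _ _ (ySharp_zero.mono (zero_le_one))).nonneg
    linarith
  -- `K (Fs n) = K Flim + H n` with `H n := K (Fs n − Flim)` X-small
  have hH : ∀ n, XSharp a (K (fun z => Fs n z - Flim z)) (A * (4 * ε * (1 / 2) ^ n)) := fun n => hK1 _ _ (hYdiff n)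
  have hsplit : ∀ n, K (Fs n) y = K Flim y + K (fun z => Fs n z - Flim z) y := fun n =>
    sharp_picard_K_sub hK2 (hb n).1 hYlim y
  have hsplitD : ∀ n, fderiv ℝ (K (Fs n)) y = fderiv ℝ (K Flim) y + fderiv ℝ (K (fun z => Fs n z - Flim z)) y := by
    intro n
    have e : K (Fs n) = fun z => K Flim z + K (fun z => Fs n z - Flim z) z :=
      funext (sharp_picard_K_sub hK2 (hb n).1 hYlim)
    rw [e]
    exact fderiv_fun_add (hKlim.1.differentiable (by norm_num) y) ((hH n).1.differentiable (by norm_num) y)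
  have hApow : Tendsto (fun n : ℕ => A * (4 * ε * (1 / 2 : ℝ) ^ n)) atTop (𝓝 0) := by
    have h := hpow0.const_mul A
    rwa [mul_zero] at h
  have hHv : Tendsto (fun n => K (fun z => Fs n z - Flim z) y) atTop (𝓝 0) := by
    rw [tendsto_zero_iff_norm_tendsto_zero]
    exact squeeze_zero (fun n => norm_nonneg _) (fun n => ((hH n).norm_le' (by linarith) y).1) hApow
  have hHD : Tendsto (fun n => fderiv ℝ (K (fun z => Fs n z - Flim z)) y) atTop (𝓝 0) := by
    rw [tendsto_zero_iff_norm_tendsto_zero]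
    exact squeeze_zero (fun n => norm_nonneg _) (fun n => ((hH n).norm_le' (by linarith) y).2) hApow
  have hv : Tendsto (fun n => K (Fs n) y) atTop (𝓝 (K Flim y)) := by
    have h := (tendsto_const_nhds (x := K Flim y)).add hHv
    rw [add_zero] at h
    exact h.congr fun n => (hsplit n).symm
  have hL : Tendsto (fun n => fderiv ℝ (K (Fs n)) y) atTop (𝓝 (fderiv ℝ (K Flim) y)) := by
    have h := (tendsto_const_nhds (x := fderiv ℝ (K Flim) y)).add hHD
    rw [add_zero] at h
    exact h.congr fun n => (hsplitD n).symm
  have happ : Tendsto (fun n => fderiv ℝ (K (Fs n)) y (K (Fs n) y)) atTop (𝓝 (fderiv ℝ (K Flim) y (K Flim y))) := by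
    have hc : Continuous fun q : (EuclideanSpace ℝ (Fin 3) →L[ℝ] EuclideanSpace ℝ (Fin 3)) × EuclideanSpace ℝ (Fin 3) =>
        q.1 q.2 := isBoundedBilinearMap_apply.continuous
    exact (hc.tendsto (fderiv ℝ (K Flim) y, K Flim y)).comp (hL.prodMk_nhds hv)
  have hrhs : Tendsto (fun n => -r y - fderiv ℝ (K (Fs n)) y (K (Fs n) y)) atTop
      (𝓝 (-r y - fderiv ℝ (K Flim) y (K Flim y))) := tendsto_const_nhds.sub happ
  have hlhs : Tendsto (fun n => Fs (n + 1) y) atTop (𝓝 (Flim y)) := (hFlim y).comp (tendsto_add_atTop_nat 1)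
  have heq : (fun n => Fs (n + 1) y) = fun n => -r y - fderiv ℝ (K (Fs n)) y (K (Fs n) y) :=
    funext fun n => congrFun (hsucc n) y
  rw [heq] at hlhs
  exact tendsto_nhds_unique hlhs hrhs

end SharpPicard

end Summit.NavierStokesRegularity.NavierStokesRegularity.Theorems.KelvinGate

end
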